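import Summits.Schanuel.Schanuel.Theorems.RootDecomp1ELWTransport01

/-!
# RootDecomp1ELWTransport — lens 2, generation 39 «LW-PAIR NORM TRANSPORT CELL» (lane E-R18 (a)): S ITSELF on the class `InLWClass` (E-doubled moment curves over a dyadic 2-fold-hyper-Liouville T), engine `algebraicIndependent_lwPt` mod `hLW : LWMeasure` — continuation (RootDecomp1ELWTransport02): §1 (second half): `halve`, one step and the iteration `descend`, `aeval_step`, `norm_aeval_descend_le`

(lens-2 g39 `LWTransport.lean` [HOME/decomp-schanuel-lens-2/g39/ sha256 cff5d88d…e8f0, 2208 l; NODE L1907 / REQUEST L1908; critic VERDICT L1909 (CLEARED, E-R18 (a) cell credit, port GO)]; port by census-1 gen 17 as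
`RootDecomp1ELWTransport01`–`09` — see the PORT NOTE of part 01; `--supports stmt-Schanuel-31409`; rung 0.)
-/

noncomputable section

open Complex Polynomial
open Literature.NumberTheory.Transcendental (zlen zlen_nonneg zlen_add_le zlen_monomial_le zlen_sum_le
  zlen_mul_le zlen_pow_le)

namespace Summit.Schanuel.Schanuel.Theorems.RootDecomp1ELWTransport

namespace NormDescent

/-! ### evenness and halving -/

/-- every monomial of `g` has even exponents -/
def IsEven (g : P2) : Prop := ∀ m ∈ g.support, 2 ∣ m 0 ∧ 2 ∣ m 1

/-- `IsEven g` (for `{g : P2} (h10 : sgn e10 g = g) (h01 : sgn e01 g = g)`). -/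
theorem isEven_of_sgn_invariant {g : P2} (h10 : sgn e10 g = g) (h01 : sgn e01 g = g) : IsEven g := by
  intro m hm
  rw [MvPolynomial.mem_support_iff] at hm
  constructor
  · by_contra hodd
    have h1 := coeff_sgn e10 g m
    rw [h10] at h1
    have h2 : (∏ i, e10 i ^ m i : ℤ) = -1 := by
      rw [Fin.prod_univ_two]
      simp only [e10, Matrix.cons_val_zero, Matrix.cons_val_one, one_pow, mul_one]
      exact Odd.neg_one_pow (Nat.odd_iff.mpr (Nat.two_dvd_ne_zero.mp hodd))
    rw [h2] at h1
    have : g.coeff m = 0 := by linarith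
    exact hm this
  · by_contra hodd
    have h1 := coeff_sgn e01 g m
    rw [h01] at h1
    have h2 : (∏ i, e01 i ^ m i : ℤ) = -1 := by
      rw [Fin.prod_univ_two]
      simp only [e01, Matrix.cons_val_zero, Matrix.cons_val_one, one_pow, one_mul]
      exact Odd.neg_one_pow (Nat.odd_iff.mpr (Nat.two_dvd_ne_zero.mp hodd))
    rw [h2] at h1
    have : g.coeff m = 0 := by linarith
    exact hm this

/-- `IsEven (quad f)` (for `(f : P2)`). -/
theorem isEven_quad (f : P2) : IsEven (quad f) :=
  isEven_of_sgn_invariant (sgn_e10_quad f) (sgn_e01_quad f)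

/-- halve the exponents -/
def half (m : Fin 2 →₀ ℕ) : Fin 2 →₀ ℕ := Finsupp.mapRange (fun e => e / 2) (Nat.zero_div 2) m

/-- `half m i = m i / 2` (for `(m : Fin 2 →₀ ℕ) (i : Fin 2)`). -/
@[simp] theorem half_apply (m : Fin 2 →₀ ℕ) (i : Fin 2) : half m i = m i / 2 := by
  simp [half]

/-- `m = m'`. -/
theorem half_inj_of_even {m m' : Fin 2 →₀ ℕ} (hm : 2 ∣ m 0 ∧ 2 ∣ m 1) (hm' : 2 ∣ m' 0 ∧ 2 ∣ m' 1)
    (h : half m = half m') : m = m' := by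
  have h0 : m 0 / 2 = m' 0 / 2 := by have := DFunLike.congr_fun h 0; simpa using this
  have h1 : m 1 / 2 = m' 1 / 2 := by have := DFunLike.congr_fun h 1; simpa using this
  have e0 : m 0 = m' 0 := by
    have := Nat.div_mul_cancel hm.1; have := Nat.div_mul_cancel hm'.1; omega
  have e1 : m 1 = m' 1 := by
    have := Nat.div_mul_cancel hm.2; have := Nat.div_mul_cancel hm'.2; omega
  ext i
  rcases Fin.exists_fin_two.mp ⟨i, rfl⟩ with h | h
  · rw [h]; exact e0
  · rw [h]; exact e1

/-- `g(X², Y²) ↦ g(X, Y)` on even polynomials: halve every exponent. -/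
def halve (g : P2) : P2 := ∑ m ∈ g.support, MvPolynomial.monomial (half m) (g.coeff m)

/-- `zlen (halve g) ≤ zlen g` (for `(g : P2)`). -/
theorem zlen_halve_le (g : P2) : zlen (halve g) ≤ zlen g := by
  unfold halve
  refine (zlen_sum_le _ _).trans ?_
  rw [zlen]
  exact Finset.sum_le_sum fun m _ => zlen_monomial_le _ _

/-- `(halve g).totalDegree ≤ g.totalDegree / 2` (for `(g : P2)`). -/
theorem totalDegree_halve_le (g : P2) : (halve g).totalDegree ≤ g.totalDegree / 2 := by
  unfold halve
  refine (MvPolynomial.totalDegree_finsetSum _ _).trans (Finset.sup_le fun m hm => ?_)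
  refine (MvPolynomial.totalDegree_monomial_le _ _).trans ?_
  have h1 : ((half m).sum fun _ => id) = m 0 / 2 + m 1 / 2 := by
    rw [Finsupp.sum_fintype _ _ (fun _ => rfl), Fin.sum_univ_two]
    simp only [half_apply, id]
  have h2 : (m.sum fun _ e => e) = m 0 + m 1 := by
    rw [Finsupp.sum_fintype _ _ (fun _ => rfl), Fin.sum_univ_two]
  have h3 : (m.sum fun _ e => e) ≤ g.totalDegree := MvPolynomial.le_totalDegree hm
  have h4 : ((half m).sum fun _ => id) ≤ g.totalDegree / 2 := by
    rw [h1]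
    calc m 0 / 2 + m 1 / 2 ≤ (m 0 + m 1) / 2 := Nat.add_div_le_add_div _ _ _
      _ ≤ g.totalDegree / 2 := Nat.div_le_div_right (h2 ▸ h3)
  exact h4

/-- `(halve g).coeff (half m₀) = g.coeff m₀` (for `{g : P2} (hg : IsEven g) {m₀ : Fin 2 →₀ ℕ} (hm₀ : m₀ ∈ g.support)`). -/
theorem coeff_halve_of_even {g : P2} (hg : IsEven g) {m₀ : Fin 2 →₀ ℕ} (hm₀ : m₀ ∈ g.support) :
    (halve g).coeff (half m₀) = g.coeff m₀ := by
  unfold halve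
  rw [MvPolynomial.coeff_sum]
  simp only [MvPolynomial.coeff_monomial]
  rw [Finset.sum_eq_single m₀]
  · rw [if_pos rfl]
  · intro m hm hne
    rw [if_neg]
    intro h
    exact hne (half_inj_of_even (hg m hm) (hg m₀ hm₀) h)
  · intro h; exact absurd hm₀ h

/-- `halve g ≠ 0` (for `{g : P2} (hg : IsEven g) (hg0 : g ≠ 0)`). -/
theorem halve_ne_zero_of_even {g : P2} (hg : IsEven g) (hg0 : g ≠ 0) : halve g ≠ 0 := by
  obtain ⟨m₀, hm₀⟩ := MvPolynomial.ne_zero_iff.mp hg0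
  have hmem : m₀ ∈ g.support := MvPolynomial.mem_support_iff.mpr hm₀
  intro h0
  have h1 := coeff_halve_of_even hg hmem
  rw [h0, MvPolynomial.coeff_zero] at h1
  exact hm₀ h1.symm

/-- `(halve g)(w₀², w₁²) = g(w₀, w₁)` for even `g`. -/
theorem aeval_halve_of_even {g : P2} (hg : IsEven g) (w : Fin 2 → ℂ) :
    MvPolynomial.aeval (fun i => w i ^ 2) (halve g) = MvPolynomial.aeval w g := by
  conv_rhs => rw [g.as_sum]
  unfold halve
  rw [map_sum, map_sum]
  refine Finset.sum_congr rfl fun m hm => ?_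
  rw [MvPolynomial.aeval_monomial, MvPolynomial.aeval_monomial,
    Finsupp.prod_fintype _ _ (fun i => by simp), Finsupp.prod_fintype _ _ (fun i => by simp)]
  congr 1
  refine Finset.prod_congr rfl fun i _ => ?_
  rw [half_apply, ← pow_mul]
  congr 1
  have h := hg m hm
  fin_cases i
  · exact Nat.mul_div_cancel' h.1
  · exact Nat.mul_div_cancel' h.2

/-! ### one step and the iteration -/

/-- one descent step: `step f (X², Y²) = quad f (X, Y)` -/
def step (f : P2) : P2 := halve (quad f)

/-- `m` descent steps -/
def descend : ℕ → P2 → P2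
  | 0, f => f
  | j + 1, f => step (descend j f)

/-- The iterated descent of a non-zero polynomial is non-zero: `descend j f ≠ 0`. -/
theorem descend_ne_zero {f : P2} (hf : f ≠ 0) : ∀ j, descend j f ≠ 0
  | 0 => hf
  | j + 1 => halve_ne_zero_of_even (isEven_quad _) (quad_ne_zero (descend_ne_zero hf j))

/-- Degree growth of the descent: `totalDegree (descend j f) ≤ 2^j · totalDegree f`. -/
theorem totalDegree_descend_le (f : P2) : ∀ j, (descend j f).totalDegree ≤ 2 ^ j * f.totalDegree
  | 0 => by simp [descend]
  | j + 1 => by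
    show (halve (quad (descend j f))).totalDegree ≤ _
    have h1 := totalDegree_halve_le (quad (descend j f))
    have h2 := totalDegree_quad_le (descend j f)
    have h3 := totalDegree_descend_le f j
    calc (halve (quad (descend j f))).totalDegree ≤ (quad (descend j f)).totalDegree / 2 := h1
      _ ≤ (4 * (descend j f).totalDegree) / 2 := Nat.div_le_div_right h2
      _ = 2 * (descend j f).totalDegree := by omega
      _ ≤ 2 * (2 ^ j * f.totalDegree) := by gcongr
      _ = 2 ^ (j + 1) * f.totalDegree := by ring

/-- Length growth of the descent: `zlen (descend j f) ≤ (zlen f)^(4^j)`. -/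
theorem zlen_descend_le (f : P2) : ∀ j, zlen (descend j f) ≤ zlen f ^ 4 ^ j
  | 0 => by simp [descend]
  | j + 1 => by
    show zlen (halve (quad (descend j f))) ≤ _
    calc zlen (halve (quad (descend j f))) ≤ zlen (quad (descend j f)) := zlen_halve_le _
      _ ≤ zlen (descend j f) ^ 4 := zlen_quad_le _
      _ ≤ (zlen f ^ 4 ^ j) ^ 4 := by
          gcongr
          · exact zlen_nonneg _
          · exact zlen_descend_le f j
      _ = zlen f ^ 4 ^ (j + 1) := by rw [← pow_mul]; ring_nf

/-- `‖g(w)‖ ≤ length(g) · R^{deg g}` for `‖wᵢ‖ ≤ R`, `R ≥ 1`. -/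
theorem norm_aeval_le (g : P2) {w : Fin 2 → ℂ} {R : ℝ} (hR : 1 ≤ R) (hw : ∀ i, ‖w i‖ ≤ R) :
    ‖MvPolynomial.aeval w g‖ ≤ zlen g * R ^ g.totalDegree := by
  conv_lhs => rw [g.as_sum]
  rw [map_sum, zlen, Finset.sum_mul]
  refine (norm_sum_le _ _).trans (Finset.sum_le_sum fun m hm => ?_)
  rw [MvPolynomial.aeval_monomial, norm_mul, Finsupp.prod_fintype _ _ (fun i => by simp),
    algebraMap_int_eq, eq_intCast, Complex.norm_intCast, norm_prod]
  refine mul_le_mul_of_nonneg_left ?_ (abs_nonneg _)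
  calc ∏ i, ‖w i ^ m i‖ ≤ ∏ i : Fin 2, R ^ m i := by
        refine Finset.prod_le_prod (fun i _ => norm_nonneg _) fun i _ => ?_
        rw [norm_pow]; exact pow_le_pow_left₀ (norm_nonneg _) (hw i) _
    _ = R ^ (m 0 + m 1) := by rw [Fin.prod_univ_two, pow_add]
    _ ≤ R ^ g.totalDegree := by
        refine pow_le_pow_right₀ hR ?_
        have h2 : m.sum (fun _ e => e) = m 0 + m 1 := by
          rw [Finsupp.sum_fintype _ _ (fun _ => rfl), Fin.sum_univ_two]
        exact h2 ▸ MvPolynomial.le_totalDegree hm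

/-- the evaluation identity of one step: `(step f)(w²) = f(w) f(−w₀,w₁) f(w₀,−w₁) f(−w₀,−w₁)`. -/
theorem aeval_step (f : P2) (w : Fin 2 → ℂ) :
    MvPolynomial.aeval (fun i => w i ^ 2) (step f) =
      MvPolynomial.aeval w f * MvPolynomial.aeval (fun i => (e10 i : ℂ) * w i) f *
        MvPolynomial.aeval (fun i => (e01 i : ℂ) * w i) f *
        MvPolynomial.aeval (fun i => (e11 i : ℂ) * w i) f := by
  unfold step
  rw [aeval_halve_of_even (isEven_quad f)]
  unfold quad
  rw [map_mul, map_mul, map_mul, aeval_sgn, aeval_sgn, aeval_sgn]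

/-- **The descent bound.**  If `‖wᵢ^{2^j}‖ ≤ R` (`R ≥ 1`) for all `j ≤ m`, then
`‖(descend m f)(w^{2^m})‖ ≤ ‖f(w)‖ · length(f)^{4^m} · R^{3·2^m·deg f}`. -/
theorem norm_aeval_descend_le {f : P2} (hf : f ≠ 0) (w : Fin 2 → ℂ) {R : ℝ} (hR : 1 ≤ R) :
    ∀ m : ℕ, (∀ j ≤ m, ∀ i, ‖w i ^ 2 ^ j‖ ≤ R) →
      ‖MvPolynomial.aeval (fun i => w i ^ 2 ^ m) (descend m f)‖ ≤
        ‖MvPolynomial.aeval w f‖ * (zlen f ^ 4 ^ m * R ^ (3 * 2 ^ m * f.totalDegree))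
  | 0, _ => by
    have h1 : (1 : ℝ) ≤ zlen f ^ 4 ^ 0 * R ^ (3 * 2 ^ 0 * f.totalDegree) :=
      one_le_mul_of_one_le_of_one_le (by rw [pow_zero, pow_one]; exact one_le_zlen hf)
        (one_le_pow₀ hR)
    have h2 : (fun i => w i ^ 2 ^ 0) = w := funext fun i => by rw [pow_zero, pow_one]
    rw [show descend 0 f = f from rfl, h2]
    exact le_mul_of_one_le_right (norm_nonneg _) h1
  | m + 1, hw => by
    have ih := norm_aeval_descend_le hf w hR m (fun j hj => hw j (by omega))
    set wm : Fin 2 → ℂ := fun i => w i ^ 2 ^ m with hwm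
    have hpow : (fun i => w i ^ 2 ^ (m + 1)) = fun i => wm i ^ 2 := by
      funext i; rw [hwm, ← pow_mul, pow_succ]
    rw [hpow]
    show ‖MvPolynomial.aeval (fun i => wm i ^ 2) (step (descend m f))‖ ≤ _
    rw [aeval_step, norm_mul, norm_mul, norm_mul]
    -- bounds for the three twisted factors
    have hwR : ∀ i, ‖wm i‖ ≤ R := fun i => hw m (by omega) i
    have hD := totalDegree_descend_le f m
    have hL := zlen_descend_le f m
    have hL0 : 0 ≤ zlen f := zlen_nonneg f
    have hfac : ∀ ε : Fin 2 → ℤ, (∀ i, |ε i| = 1) →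
        ‖MvPolynomial.aeval (fun i => (ε i : ℂ) * wm i) (descend m f)‖ ≤
          zlen f ^ 4 ^ m * R ^ (2 ^ m * f.totalDegree) := by
      intro ε hε
      have hw' : ∀ i, ‖(ε i : ℂ) * wm i‖ ≤ R := by
        intro i
        rw [norm_mul, Complex.norm_intCast]
        have : |((ε i : ℤ) : ℝ)| = 1 := by exact_mod_cast hε i
        rw [this, one_mul]; exact hwR i
      calc ‖MvPolynomial.aeval (fun i => (ε i : ℂ) * wm i) (descend m f)‖
          ≤ zlen (descend m f) * R ^ (descend m f).totalDegree := norm_aeval_le _ hR hw'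
        _ ≤ zlen f ^ 4 ^ m * R ^ (2 ^ m * f.totalDegree) :=
            mul_le_mul hL (pow_le_pow_right₀ hR hD) (by positivity) (pow_nonneg hL0 _)
    have h10 := hfac e10 (fun i => by fin_cases i <;> rfl)
    have h01 := hfac e01 (fun i => by fin_cases i <;> rfl)
    have h11 := hfac e11 (fun i => by fin_cases i <;> rfl)
    set B : ℝ := zlen f ^ 4 ^ m * R ^ (2 ^ m * f.totalDegree) with hB
    have hB0 : 0 ≤ B := by positivity
    set A0 : ℝ := ‖MvPolynomial.aeval w f‖ * (zlen f ^ 4 ^ m * R ^ (3 * 2 ^ m * f.totalDegree))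
      with hA0
    calc ‖MvPolynomial.aeval wm (descend m f)‖ *
          ‖MvPolynomial.aeval (fun i => (e10 i : ℂ) * wm i) (descend m f)‖ *
          ‖MvPolynomial.aeval (fun i => (e01 i : ℂ) * wm i) (descend m f)‖ *
          ‖MvPolynomial.aeval (fun i => (e11 i : ℂ) * wm i) (descend m f)‖
        ≤ A0 * B * B * B := by gcongr
      _ = ‖MvPolynomial.aeval w f‖ *
          (zlen f ^ (4 ^ m * 4) * R ^ (3 * 2 ^ m * f.totalDegree + 3 * (2 ^ m * f.totalDegree))) := by
          rw [hA0, hB]; ring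
      _ = ‖MvPolynomial.aeval w f‖ *
          (zlen f ^ 4 ^ (m + 1) * R ^ (3 * 2 ^ (m + 1) * f.totalDegree)) := by
          (congr 3; ring)

end NormDescent

end Summit.Schanuel.Schanuel.Theorems.RootDecomp1ELWTransport

end
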